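import Summits.AtomisticToContinuum.Crystallization.Theorems.FrustratedLawDichotomyStrainedPatchHomCurvLeafL2

/-!
# Per-label second-order floor for the PURE Lennard-Jones profile (the LJ7 one-atom `B`-field of the exemption of record)

decomp-a2c hand-1 g28 (crux `AperiodicFrustratedLawGap`, stmt-AtomisticToContinuum-27623; `(H) HomFloor (1/625)`, hcp half; critic rows 1085/1089 (3):
«c_λ measurement — the LJ7 force-JACOBIAN kit = CurvCentre machinery one potential over; hand-1 chooses certify-LJ7-directly vs carry the W₄₅ difference»
— CHOICE: certify LJ7 DIRECTLY).  The force-Jacobian floor `λ` of hand-2's ring lemma `…HomForceRing.hcpForceLJ_slab_confinement` is a floor of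
`Σ_b segGd (fun x => x⁻¹^7 − x⁻¹^13) (p_b(ξ₀)) (U(ξ−ξ₀)) s` — the curvature sum of the PURE LJ pair potential (`V′ = r⁻⁷ − r⁻¹³`), which has NO regimes
and NO junctions: its rank-one coefficients are the closed forms `alphaLJ`, `betaLJ` of `…HomCurvRegime3` at EVERY radius `r > 0`.  So the centred
second-order machinery (`…HomHessPath.pathForm_secondOrder`, `…HomCurvCoeff3.ljTripleFI/kBound_of_mem`, `…HomCurvCentreLabel.floor_core`, v2 tube) gives
a per-label floor for ANY label whose tube has positive lower end:

* §1 `deriv_ljProfile`, `alphaLJ_eq_profile`, `betaLJ_eq_profile`, ★ `segGd_ljProfile_eq` (`segGd V′ p Δ s = alphaLJ ρ ⟪c,Δ⟫² + betaLJ ρ ‖Δ‖²`),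
  `betaLJ_of_mem_phiFI` (centre `β₀` from `…HomForceKit.phiFI`);
* §2 ★★ `label_floor_LJ` — hypotheses = the kernel's `Option` equations (`ljTripleFI` on tube² and at the centre, `phiFI`, `divPos`), conclusion = the
  four facts of `…HomCurvLeafL2.label_floor2` with `αT := alphaLJ`, `βT := betaLJ`, `a₁ := alpha1LJ ρ₀/ρ₀`.

NO definitions; 0 sorry; standard axioms; no instances / notation / `#eval`.  `--supports stmt-AtomisticToContinuum-27623`.
-/

noncomputable section

namespace Summit.AtomisticToContinuum.Crystallization.Theorems.FrustratedLawDichotomyStrainedPatchHomCurvLJ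

open scoped BigOperators RealInnerProductSpace
open Literature.Analysis.ValidatedNumerics.Numerics
open Summit.AtomisticToContinuum.Crystallization.Theorems.ChargedEnergyGapNegative (E3)
open Summit.AtomisticToContinuum.Crystallization.Theorems.FrustratedLawDichotomyStrainedPatchHomSplit (latPt hexFrame hcpShift)
open Summit.AtomisticToContinuum.Crystallization.Theorems.FrustratedLawDichotomyStrainedPatchHomEntryGramHcp (dot3 mem_dot3)
open Summit.AtomisticToContinuum.Crystallization.Theorems.FrustratedLawDichotomyStrainedPatchHomForceKit (phiFI mem_phiFI)
open Summit.AtomisticToContinuum.Crystallization.Theorems.FrustratedLawDichotomyStrainedPatchHomCurvCoeff3 (ljTripleFI mem_ljTripleFI kTermS kBound_of_mem)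
open Summit.AtomisticToContinuum.Crystallization.Theorems.FrustratedLawDichotomyStrainedPatchHomCurvRegime3
open Summit.AtomisticToContinuum.Crystallization.Theorems.FrustratedLawDichotomyStrainedPatchHomCurvCentreKit
open Summit.AtomisticToContinuum.Crystallization.Theorems.FrustratedLawDichotomyStrainedPatchHomHessPath (pathForm_secondOrder)
open Summit.AtomisticToContinuum.Crystallization.Theorems.FrustratedLawDichotomyStrainedPatchHomConvexCurvature (segGd_eq_rankOne)
open Summit.AtomisticToContinuum.Crystallization.Theorems.FrustratedLawDichotomyStrainedPatchTaylorChord (segR segGd)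

/-! ## §1. The pure LJ profile: closed-form coefficients at every radius -/

/-- `d/dr (r⁻⁷ − r⁻¹³) = −7r⁻⁸ + 13r⁻¹⁴` (`r ≠ 0`). [arithmetic] -/
theorem hasDerivAt_ljProfile' {r : ℝ} (hr : r ≠ 0) :
    HasDerivAt (fun x : ℝ => x⁻¹ ^ 7 - x⁻¹ ^ 13) (-7 * r⁻¹ ^ 8 + 13 * r⁻¹ ^ 14) r := by
  have h1 : HasDerivAt (fun s : ℝ => s⁻¹) (-(r ^ 2)⁻¹) r := hasDerivAt_inv hr
  have h := (h1.fun_pow 7).fun_sub (h1.fun_pow 13)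
  refine h.congr_deriv ?_
  have e8 : (r⁻¹) ^ 8 = (r⁻¹) ^ 6 * (r ^ 2)⁻¹ := by rw [← inv_pow]; ring
  have e14 : (r⁻¹) ^ 14 = (r⁻¹) ^ 12 * (r ^ 2)⁻¹ := by rw [← inv_pow]; ring
  rw [e8, e14]
  push_cast
  ring

/-- `deriv (r⁻⁷ − r⁻¹³) = −7r⁻⁸ + 13r⁻¹⁴`. [arithmetic] -/
theorem deriv_ljProfile {r : ℝ} (hr : r ≠ 0) : deriv (fun x : ℝ => x⁻¹ ^ 7 - x⁻¹ ^ 13) r = -7 * r⁻¹ ^ 8 + 13 * r⁻¹ ^ 14 :=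
  (hasDerivAt_ljProfile' hr).deriv

/-- ★ `(V″ − V′/r)/r² = alphaLJ r` for the pure LJ profile, every `r ≠ 0`. [arithmetic] -/
theorem alphaLJ_eq_profile {r : ℝ} (hr : r ≠ 0) :
    (deriv (fun x : ℝ => x⁻¹ ^ 7 - x⁻¹ ^ 13) r - (r⁻¹ ^ 7 - r⁻¹ ^ 13) / r) / r ^ 2 = alphaLJ r := by
  rw [deriv_ljProfile hr, alphaLJ]
  field_simp
  ring

/-- ★ `V′/r = betaLJ r` for the pure LJ profile, every `r ≠ 0`. [arithmetic] -/
theorem betaLJ_eq_profile {r : ℝ} (hr : r ≠ 0) : (r⁻¹ ^ 7 - r⁻¹ ^ 13) / r = betaLJ r := by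
  rw [betaLJ]
  field_simp

/-- ★ **The per-label curvature term of the pure LJ profile in rank-one form** (`ρ_s ≠ 0`):
`segGd V′ p Δ s = alphaLJ ρ_s ⟪p + sΔ, Δ⟫² + betaLJ ρ_s ‖Δ‖²`. [folklore chaining] -/
theorem segGd_ljProfile_eq (p Δ : E3) {s : ℝ} (h0 : segR p Δ s ≠ 0) :
    segGd (fun x : ℝ => x⁻¹ ^ 7 - x⁻¹ ^ 13) p Δ s = alphaLJ (segR p Δ s) * ⟪p + s • Δ, Δ⟫ ^ 2 + betaLJ (segR p Δ s) * ‖Δ‖ ^ 2 := by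
  rw [segGd_eq_rankOne _ _ _ h0, alphaLJ_eq_profile h0, betaLJ_eq_profile h0]

/-- `betaLJ ρ ∈ phiFI Q` whenever `ρ² ∈ Q`. [folklore chaining: `…HomForceKit.mem_phiFI`] -/
theorem betaLJ_of_mem_phiFI {ρ : ℝ} {Q P : FI} (hq : FI.mem (ρ ^ 2) Q) (h : phiFI Q = some P) : FI.mem (betaLJ ρ) P := by
  have hm := mem_phiFI hq h
  have e : ((ρ ^ 2)⁻¹) ^ 4 - ((ρ ^ 2)⁻¹) ^ 7 = betaLJ ρ := by rw [betaLJ, ← inv_pow, ← pow_mul, ← pow_mul]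
  rw [← e]; exact hm

/-! ## §2. ★★ The per-label floor (any label with a positive tube) -/

/-- ★★ **PER-LABEL SECOND-ORDER FLOOR, PURE LJ PROFILE** (v2 tube with positive lower end; no regime, no junction). [folklore chaining:
`pathForm_secondOrder` + `ljTripleFI`/`kBound_of_mem` + `floor_core`] -/
theorem label_floor_LJ {c w : (Fin 3 × Fin 3) ⊕ Fin 3 → ℤ} {b : Fin 3 → ℤ} (hlo : 0 < (tube2 c w b).lo)
    {tt t0 : FI × FI × FI} {B0 a1q : FI}
    (htt : ljTripleFI ((tube2 c w b).mul (tube2 c w b)) = some tt)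
    (ht0 : ljTripleFI (dot3 (cenVec c b) (cenVec c b)) = some t0)
    (hb0 : phiFI (dot3 (cenVec c b) (cenVec c b)) = some B0) (hq : FI.divPos t0.2.1 (dot3 (cenVec c b) (cenVec c b)) = some a1q)
    (U : E3 →L[ℝ] E3)
    (hbox : ∀ ab : Fin 3 × Fin 3, |(U (EuclideanSpace.single ab.2 (1 : ℝ))) ab.1 - (c (Sum.inl ab) : ℝ) / SC| ≤ (w (Sum.inl ab) : ℝ) / SC)
    (η : E3) (hη : ∀ i : Fin 3, |η i - (c (Sum.inr i) : ℝ) / SC| ≤ (w (Sum.inr i) : ℝ) / SC) (Δ : E3) :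
    FI.mem (alphaLJ ‖cenPt c b‖) t0.1 ∧ FI.mem (betaLJ ‖cenPt c b‖) B0 ∧ FI.mem (alpha1LJ ‖cenPt c b‖ / ‖cenPt c b‖) a1q ∧
      alphaLJ ‖cenPt c b‖ * ⟪cenPt c b, Δ⟫ ^ 2 + betaLJ ‖cenPt c b‖ * ‖Δ‖ ^ 2 +
          ∑ i, ∑ j, (∑ k, (latPt U hexFrame b + U (hcpShift + η) - cenPt c b) k *
            Dreal (alpha1LJ ‖cenPt c b‖ / ‖cenPt c b‖) (alphaLJ ‖cenPt c b‖) (cenPt c b) k i j) * (Δ i * Δ j) -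
          ((kTermS tt.1 tt.2.1 tt.2.2) : ℝ) / SC / 2 * ((nd2S2 c w b : ℝ) / SC) * ‖Δ‖ ^ 2 ≤
        alphaLJ ‖latPt U hexFrame b + U (hcpShift + η)‖ * ⟪latPt U hexFrame b + U (hcpShift + η), Δ⟫ ^ 2 +
          betaLJ ‖latPt U hexFrame b + U (hcpShift + η)‖ * ‖Δ‖ ^ 2 := by
  have hS : (0 : ℝ) < SC := by norm_num [SC]
  set T := tube2 c w b with hT
  set p := cenPt c b with hp
  set cb := latPt U hexFrame b + U (hcpShift + η) with hcb
  set d := cb - p with hd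
  set aa : ℝ := (T.lo : ℝ) / SC with haa
  set bb : ℝ := (T.hi : ℝ) / SC with hbb
  have ha : 0 < aa := div_pos (by exact_mod_cast hlo) hS
  have hreg' : ∀ r, aa < r → r < bb → r ≠ 0 := fun r h1 _ => (ha.trans h1).ne'
  have htube : ∀ t ∈ Set.Icc (0 : ℝ) 1, aa < segR p d t ∧ segR p d t < bb := fun t ht => by
    have := tube2_mem U hbox η hη b ht
    simpa [segR, hp, hd, hcb] using this
  -- the one-sided second-order expansion on the tube
  set K : ℝ := (kTermS tt.1 tt.2.1 tt.2.2 : ℝ) / SC with hKdef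
  have hPF := pathForm_secondOrder (A := alphaLJ) (A₁ := alpha1LJ) (A₂ := alpha2LJ) (B := betaLJ) (B₁ := fun s => alphaLJ s * s)
    (B₂ := fun s => alpha1LJ s * s + alphaLJ s) (K := K) (p := p) (d := d) (Δ := Δ) ha htube
    (fun r h1 h2 => hasDerivAt_alphaLJ (hreg' r h1 h2))
    (fun r h1 h2 => hasDerivAt_alpha1LJ (hreg' r h1 h2))
    (fun r h1 h2 => hasDerivAt_betaLJ (hreg' r h1 h2))
    (fun r h1 h2 => hasDerivAt_alphaLJ_mul (hreg' r h1 h2))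
    (fun r h1 h2 => by
      have hmT : FI.mem r T := mem_of_strict h1 h2
      have hq2 : FI.mem (r ^ 2) (T.mul T) := by rw [sq]; exact FI.mem_mul hmT hmT
      obtain ⟨m0, m1, m2⟩ := mem_ljTripleFI hq2 htt
      exact kBound_of_mem (ha.trans h1) m0 m1 m2)
  -- centre data
  have h0t := htube 0 (by simp)
  have hR0 : segR p d 0 = ‖p‖ := by simp [segR]
  rw [hR0] at h0t
  have hρpos : 0 < ‖p‖ := ha.trans h0t.1
  have hρne : ‖p‖ ≠ 0 := hρpos.ne'
  have hQ0 := (mem_rho0 c b).1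
  obtain ⟨m0c, m1c, _⟩ := mem_ljTripleFI hQ0 ht0
  have hβ0 : FI.mem (betaLJ ‖p‖) B0 := betaLJ_of_mem_phiFI hQ0 hb0
  have ha1 : FI.mem (alpha1LJ ‖p‖ / ‖p‖) a1q := by
    have := FI.mem_divPos hq m1c hQ0
    have e : alpha1LJ ‖p‖ * ‖p‖ / ‖p‖ ^ 2 = alpha1LJ ‖p‖ / ‖p‖ := by field_simp
    rw [← e]; exact this
  refine ⟨m0c, hβ0, ha1, ?_⟩
  have hpd : p + d = cb := by rw [hd]; abel
  simp only [hpd] at hPF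
  have hK0 : 0 ≤ K := div_nonneg (by exact_mod_cast kTermS_nonneg _ _ _) hS.le
  have hN : ‖d‖ ^ 2 ≤ (nd2S2 c w b : ℝ) / SC := by
    rw [le_div_iff₀ hS]; exact norm_sq_dVec2_le U hbox η hη b
  have := floor_core p d Δ hρne hK0 hN hPF
  simpa [hKdef] using this

end Summit.AtomisticToContinuum.Crystallization.Theorems.FrustratedLawDichotomyStrainedPatchHomCurvLJ

end
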